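import Summits.AtomisticToContinuum.BoseEinsteinCondensation.Theorems.BECHeatBathGapSquareSummableInfluencePairFactorisation
import Summits.AtomisticToContinuum.BoseEinsteinCondensation.Theorems.BECSwapNoCatastropheSwapToZeroModeStability
import HarnessLib

/-!
# Route `BECHeatBathGap`, crux `SquareSummableInfluence` (stmt-AtomisticToContinuum-14368), line `registered`:
# what ONE bath particle's influence buys — the Mayers representation of the mode occupations

Supports (does not close) stmt-AtomisticToContinuum-14368 (lead c6). By `pairFactorisation_le_four_mul_leastSquares`
(this line, p166314) a small least-squares influence of ONE bath particle `x_i` on a Bose-symmetric `(N+1)`-body state `Ψ`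
relative to the bath state `Θ` puts `Ψ` close in `L²` to the pair approximant
`G(Z) = c(X̂) Θ(tail Z^{i→y}) Θ(tail Z)`. This file reads that off on the one-particle density matrix:

* (imported) `occupation_rpow_half_le_add` (route `BECSwapNoCatastrophe`) — `√occ(u, ·)` is `√(n+1)`-Lipschitz in `L²` for
  raw measurable states;
* `occupation_pairApprox` — the occupation of a mode `u` in the pair approximant is the MAYERS MIXTURE functional
  `(N+1) ∫_{Λ^N} |c|² |Θ(X)|² |⟨u, Θ(X^{i→·})⟩|² dX` (weight `|c|²|Θ|²`, i.e. `|c|² m` per `X̂`, against the squared overlap of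
  `u` with the conditional one-particle amplitude `θ_X̂ = Θ(·, X̂)` of the bath state);
* `mayersRepresentation_of_leastSquares` — hence for Dirichlet, box-square-integrable, `swap(0, succ i)`-symmetric `Ψ` there is a
  pair coefficient `c(X̂)` such that for EVERY normalised mode `u`,
  `|occ(u, Ψ)^{1/2} − ((N+1)∫|c|²|Θ|²|⟨u, θ_X̂⟩|²)^{1/2}| ≤ (4 (N+1) ∫_{Λ^{N+1}}|Ψ − g⋆_i Θ(tail)|²)^{1/2}`.

For ground states `Θ₀^{(N)}, Ψ₀^{(N+1)}` the right-hand side is `2((N+1) I/N)^{1/2}` (`I` the total influence of card A2,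
`I_i = I/N` by Bose symmetry), so `λ_max(γ_{Ψ₀})/(N+1) = sup_u (Mayers functional) + O(√(I/N))`: already `I = o(N)` — one bath
particle's resampling influence `→ 0`, far less than A2's `I ≤ ε` — pins the condensate fraction of `Ψ₀` to the ALIGNMENT of the
conditional one-particle amplitudes of `Θ₀` (Mayers' heuristic `n₀/N = E|⟨φ₀, θ̂⟩|²` made conditional-rigorous), an input
alternative to the route's A1. `[folklore]` (Cauchy–Schwarz, Minkowski, Tonelli) + [cite: Mayers2001] for the reading.
-/

noncomputable section

open MeasureTheory Filter Function
open scoped ENNReal NNReal Topology ComplexConjugate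

namespace Summit.AtomisticToContinuum.BoseEinsteinCondensation.Theorems.SquareSummableInfluence

open Literature.MathematicalPhysics.QuantumManyBody.BoseGas
open Summit.AtomisticToContinuum.BoseEinsteinCondensation.Theorems.SwapToZeroMode

/-! ### The occupation of the pair approximant is the Mayers mixture functional -/

/-- Prepending then resampling bath slot `succ i`: `(x :: Y) with slot (succ i) ↦ a = x :: (Y with slot i ↦ a)`.
[folklore] -/
theorem update_vecCons_succ {n : ℕ} (x : Space) (Y : Config n) (i : Fin n) (a : Space) :
    update (Matrix.vecCons x Y : Config (n + 1)) (Fin.succ i) a = Matrix.vecCons x (update Y i a) := by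
  simp [Matrix.vecCons, Fin.cons_update]

/-- `x :: Y = (0 :: Y) with slot 0 ↦ x`. [folklore] -/
theorem vecCons_eq_update_vecCons_zero {n : ℕ} (x : Space) (Y : Config n) :
    (Matrix.vecCons x Y : Config (n + 1)) = update (Matrix.vecCons 0 Y) 0 x := by
  simp [Matrix.vecCons, Fin.update_cons_zero]

/-- **The occupation of the pair approximant.** For measurable `Θ` (bath), a measurable coefficient `c` blind to the
inserted particle (slot `0`), a bath label `i` and a mode `u`, the pair approximant
`G(Z) = c(Z) Θ(tail Z^{i→y}) Θ(tail Z)` has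
`occ(u, G) = (N+1) ∫_{(ℝ³)^N} |c(0 :: X)|² |Θ(X)|² |∫ conj u(y) Θ(X^{i→y}) dy|² dX` — the Mayers mixture functional: weight
`|c|²|Θ|²` (per `X̂`: `|c(X̂)|² m(X̂)`) against the squared overlap of `u` with the conditional one-particle amplitude
`θ_X̂ = Θ(·, X̂)`. [cite: Mayers2001, Eq. (1)–(3)] -/
theorem occupation_pairApprox {N : ℕ} {Θ : Config N → ℂ} {c : Config (N + 1) → ℂ} (i : Fin N)
    (hc0 : ∀ Z a, c (Function.update Z 0 a) = c Z) (u : Space → ℂ) :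
    occupation (N + 1) u
        (fun Z => c Z * Θ (Matrix.vecTail (Function.update Z (Fin.succ i) (Z 0))) * Θ (Matrix.vecTail Z)) =
      (N + 1 : ℝ≥0∞) * ∫⁻ X : Config N, (‖c (Matrix.vecCons 0 X)‖₊ : ℝ≥0∞) ^ 2 * (‖Θ X‖₊ : ℝ≥0∞) ^ 2 *
        (‖∫ y, conj (u y) * Θ (Function.update X i y)‖₊ : ℝ≥0∞) ^ 2 := by
  have hocc : ∀ G : Config (N + 1) → ℂ, occupation (N + 1) u G =
      (N + 1 : ℝ≥0∞) * ∫⁻ Y : Config N,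
        (‖∫ x, conj (u x) * G (Matrix.vecCons x Y)‖₊ : ℝ≥0∞) ^ 2 := fun G => rfl
  rw [hocc]
  congr 1
  refine lintegral_congr fun X => ?_
  have hslice : ∀ x : Space,
      conj (u x) * (c (Matrix.vecCons x X) *
          Θ (Matrix.vecTail (Function.update (Matrix.vecCons x X : Config (N + 1)) (Fin.succ i)
            ((Matrix.vecCons x X : Config (N + 1)) 0))) *
          Θ (Matrix.vecTail (Matrix.vecCons x X))) =
        c (Matrix.vecCons 0 X) * Θ X * (conj (u x) * Θ (Function.update X i x)) := by
    intro x
    rw [Matrix.cons_val_zero, update_vecCons_succ, Matrix.tail_cons, Matrix.tail_cons,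
      vecCons_eq_update_vecCons_zero x X, hc0]
    ring
  simp only [hslice]
  rw [integral_const_mul, nnnorm_mul, nnnorm_mul, ENNReal.coe_mul, ENNReal.coe_mul, mul_pow, mul_pow]

/-! ### The Mayers representation from one bath particle's least-squares influence -/

/-- **Mayers representation of the mode occupations.** Let `Θ : Λ_L^N → ℂ` (bath) and `Ψ : Λ_L^{N+1} → ℂ` be measurable,
vanishing off the boxes (Dirichlet), square integrable, `i` a bath label, and `Ψ ∘ swap(0, succ i) = Ψ` (Bose symmetry of the
inserted particle with bath particle `i`). Then there is a measurable pair coefficient `c` (blind to `y` and to `x_i`; the one of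
`pairFactorisation_le_four_mul_leastSquares`) such that for EVERY normalised mode `u`:
`occ(u, Ψ)^{1/2} ≤ M(u)^{1/2} + R` and `M(u)^{1/2} ≤ occ(u, Ψ)^{1/2} + R`, where
`M(u) = (N+1) ∫ |c(0::X)|² |Θ(X)|² |⟨u, Θ(X^{i→·})⟩|² dX` is the Mayers mixture functional of the conditional one-particle
amplitudes of the bath state and `R = (4 (N+1) ∫_{Λ^{N+1}} |Ψ − g⋆_i Θ(tail)|²)^{1/2}` is `√(4(N+1))` times the least-squares
influence of bath particle `i`. For ground states `R = 2((N+1) I/N)^{1/2}` with `I` the total influence of card A2: already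
`I = o(N)` identifies `λ_max(γ_{Ψ₀})/(N+1)` with `sup_u M(u)/(N+1)` asymptotically (BEC ⇔ alignment of the conditional
amplitudes). [cite: Mayers2001, Eq. (1)–(3)] -/
theorem mayersRepresentation_of_leastSquares :
    ∀ (N : ℕ) (L : ℝ) (Θ : Config N → ℂ) (Ψ : Config (N + 1) → ℂ), Measurable Θ → Measurable Ψ →
      (∀ X, X ∉ boxN N L → Θ X = 0) → (∀ Z, Z ∉ boxN (N + 1) L → Ψ Z = 0) →
      (∫⁻ X in boxN N L, (‖Θ X‖₊ : ℝ≥0∞) ^ 2) ≠ ⊤ →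
      (∫⁻ Z in boxN (N + 1) L, (‖Ψ Z‖₊ : ℝ≥0∞) ^ 2) ≠ ⊤ → ∀ (i : Fin N),
      (∀ Z : Config (N + 1), Ψ (Z ∘ Equiv.swap (0 : Fin (N + 1)) (Fin.succ i)) = Ψ Z) →
    ∃ c : Config (N + 1) → ℂ, Measurable c ∧ (∀ Z a, c (Function.update Z 0 a) = c Z) ∧
      (∀ Z a, c (Function.update Z (Fin.succ i) a) = c Z) ∧
      ∀ u : Space → ℂ, AEStronglyMeasurable u volume → (∫⁻ x, (‖u x‖₊ : ℝ≥0∞) ^ 2 = 1) →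
        occupation (N + 1) u Ψ ^ (1 / 2 : ℝ) ≤
          ((N + 1 : ℝ≥0∞) * ∫⁻ X : Config N, (‖c (Matrix.vecCons 0 X)‖₊ : ℝ≥0∞) ^ 2 * (‖Θ X‖₊ : ℝ≥0∞) ^ 2 *
              (‖∫ y, conj (u y) * Θ (Function.update X i y)‖₊ : ℝ≥0∞) ^ 2) ^ (1 / 2 : ℝ) +
            ((N + 1 : ℕ) : ℝ≥0∞) ^ (1 / 2 : ℝ) * (4 * ∫⁻ Z in boxN (N + 1) L, (‖Ψ Z -
              ((∫ x in box L, conj (Θ (Matrix.vecTail (Function.update Z (Fin.succ i) x))) *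
                  Ψ (Function.update Z (Fin.succ i) x)) /
                (((∫⁻ x in box L, (‖Θ (Matrix.vecTail (Function.update Z (Fin.succ i) x))‖₊ : ℝ≥0∞) ^ 2).toReal
                  : ℝ) : ℂ)) *
                Θ (Matrix.vecTail Z)‖₊ : ℝ≥0∞) ^ 2) ^ (1 / 2 : ℝ) ∧
        ((N + 1 : ℝ≥0∞) * ∫⁻ X : Config N, (‖c (Matrix.vecCons 0 X)‖₊ : ℝ≥0∞) ^ 2 * (‖Θ X‖₊ : ℝ≥0∞) ^ 2 *
              (‖∫ y, conj (u y) * Θ (Function.update X i y)‖₊ : ℝ≥0∞) ^ 2) ^ (1 / 2 : ℝ) ≤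
          occupation (N + 1) u Ψ ^ (1 / 2 : ℝ) +
            ((N + 1 : ℕ) : ℝ≥0∞) ^ (1 / 2 : ℝ) * (4 * ∫⁻ Z in boxN (N + 1) L, (‖Ψ Z -
              ((∫ x in box L, conj (Θ (Matrix.vecTail (Function.update Z (Fin.succ i) x))) *
                  Ψ (Function.update Z (Fin.succ i) x)) /
                (((∫⁻ x in box L, (‖Θ (Matrix.vecTail (Function.update Z (Fin.succ i) x))‖₊ : ℝ≥0∞) ^ 2).toReal
                  : ℝ) : ℂ)) *
                Θ (Matrix.vecTail Z)‖₊ : ℝ≥0∞) ^ 2) ^ (1 / 2 : ℝ) := by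
  intro N L Θ Ψ hΘ hΨ hΘ0 hΨ0 hΘ2 hΨ2 i hsymm
  obtain ⟨c, hcm, hc0, hci, hle⟩ :=
    pairFactorisation_le_four_mul_leastSquares N L Θ Ψ hΘ hΨ hΘ2 hΨ2 i hsymm
  refine ⟨c, hcm, hc0, hci, fun u hu hu1 => ?_⟩
  -- the pair approximant and its measurability
  set G : Config (N + 1) → ℂ := fun Z =>
    c Z * Θ (Matrix.vecTail (Function.update Z (Fin.succ i) (Z 0))) * Θ (Matrix.vecTail Z) with hG
  have hGm : Measurable G :=
    (hcm.mul (hΘ.comp (measurable_vecTail.comp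
      ((measurable_update' (a := Fin.succ i)).comp (measurable_id.prodMk (measurable_pi_apply 0)))))).mul
      (hΘ.comp measurable_vecTail)
  -- the `L²` distance on the whole space is the distance on the box (both states are Dirichlet)
  have hGzero : ∀ Z, Z ∉ boxN (N + 1) L → G Z = 0 := by
    intro Z hZ
    simp only [boxN, Set.mem_setOf_eq, not_forall] at hZ
    obtain ⟨k, hk⟩ := hZ
    simp only [hG]
    refine Fin.cases ?_ (fun j hj => ?_) k hk
    · intro h0
      have : Matrix.vecTail (Function.update Z (Fin.succ i) (Z 0)) ∉ boxN N L := by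
        intro hmem
        have h := hmem i
        rw [vecTail_update_succ, Function.update_self] at h
        exact h0 h
      rw [hΘ0 _ this, mul_zero, zero_mul]
    · have : Matrix.vecTail Z ∉ boxN N L := fun hmem => hj (hmem j)
      rw [hΘ0 _ this, mul_zero]
  have hdist : ∫⁻ Z, (‖Ψ Z - G Z‖₊ : ℝ≥0∞) ^ 2 = ∫⁻ Z in boxN (N + 1) L, (‖Ψ Z - G Z‖₊ : ℝ≥0∞) ^ 2 := by
    rw [← lintegral_indicator (measurableSet_boxN _ _)]
    refine lintegral_congr fun Z => ?_
    by_cases hZ : Z ∈ boxN (N + 1) L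
    · rw [Set.indicator_of_mem hZ]
    · rw [Set.indicator_of_notMem hZ, hΨ0 Z hZ, hGzero Z hZ, sub_zero, nnnorm_zero, ENNReal.coe_zero,
        zero_pow two_ne_zero]
  have hdist' : ∫⁻ Z, (‖G Z - Ψ Z‖₊ : ℝ≥0∞) ^ 2 = ∫⁻ Z in boxN (N + 1) L, (‖Ψ Z - G Z‖₊ : ℝ≥0∞) ^ 2 := by
    rw [← hdist]
    refine lintegral_congr fun Z => ?_
    rw [← nnnorm_neg, neg_sub]
  -- the two `√occ` comparisons and the occupation of the approximant
  have h1 := occupation_rpow_half_le_add hu hu1 hΨ hGm (c := 1) (by simp)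
  have h2 := occupation_rpow_half_le_add hu hu1 hGm hΨ (c := 1) (by simp)
  simp only [one_mul] at h1 h2
  have hoccG : occupation (N + 1) u G =
      (N + 1 : ℝ≥0∞) * ∫⁻ X : Config N, (‖c (Matrix.vecCons 0 X)‖₊ : ℝ≥0∞) ^ 2 * (‖Θ X‖₊ : ℝ≥0∞) ^ 2 *
        (‖∫ y, conj (u y) * Θ (Function.update X i y)‖₊ : ℝ≥0∞) ^ 2 := occupation_pairApprox i hc0 u
  rw [hdist] at h1
  rw [hdist'] at h2
  rw [hoccG] at h1 h2
  have hR : ((N + 1 : ℕ) : ℝ≥0∞) ^ (1 / 2 : ℝ) *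
      (∫⁻ Z in boxN (N + 1) L, (‖Ψ Z - G Z‖₊ : ℝ≥0∞) ^ 2) ^ (1 / 2 : ℝ) ≤
      ((N + 1 : ℕ) : ℝ≥0∞) ^ (1 / 2 : ℝ) * (4 * ∫⁻ Z in boxN (N + 1) L, (‖Ψ Z -
        ((∫ x in box L, conj (Θ (Matrix.vecTail (Function.update Z (Fin.succ i) x))) *
            Ψ (Function.update Z (Fin.succ i) x)) /
          (((∫⁻ x in box L, (‖Θ (Matrix.vecTail (Function.update Z (Fin.succ i) x))‖₊ : ℝ≥0∞) ^ 2).toReal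
            : ℝ) : ℂ)) *
          Θ (Matrix.vecTail Z)‖₊ : ℝ≥0∞) ^ 2) ^ (1 / 2 : ℝ) := by
    gcongr
  exact ⟨h1.trans (add_le_add_right hR _), h2.trans (add_le_add_right hR _)⟩

end Summit.AtomisticToContinuum.BoseEinsteinCondensation.Theorems.SquareSummableInfluence

end
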